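import Summits.QuantumFields.QCD.Theses.NestedDissectionSea
import Summits.QuantumFields.QCD.Theorems.NestedDissectionSeaKineticEdge

/-!
# Support lemmas for the r11 edge clause of line `proper-time-quarantine`
# (crux `SeaFactorisationBridge`, stmt-QuantumFields-13880; wave-4 audit of `stub_complementCoercive`)

Definition-free statements (the skeleton's `IsCoerciveOn` / `KSeparated` / (bad-3) bodies are written out, so
the Lines file uses them by `exact`):

* `isCoerciveOn_of_le_kineticEdge` — for EVERY `SU(3)` gauge field, every predicate `Ω` inside an open box
  of sides `s ≤ N` and every level `0 ≤ κ ≤ μ + Σ_i (1 − cos(π/s_i))`, the Wilson–Dirac matrix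
  `D_W(U, μ, 1)` is `κ`-coercive on `Ω` in SUPPORT form:
  `κ² ‖v‖² ≤ Σ_{p : Ω p.site} ‖(D_W v)_p‖²` for all `v` vanishing off `Ω` (numerical range
  `re_quadForm_wilsonDirac_ge_box` + Cauchy–Schwarz).  With `isCoerciveOn_of_le_mass` (`κ ≤ μ`): the
  clause (bad-2) "clean part not coercive at the valence level `c_h a_k m_f/Z_m(k)`" of `BadBox` is a
  surely-absent event at every step with `m_f(k) ≥ c_h a_k m_f/Z_m(k)`.
* `exists_threshold_iff_exists_index` — a threshold-count event `∃ x ≥ 0, c x < #{i : |e i| ≤ x τ}`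
  over finitely many reals is the FINITE disjunction `∃ i, c (|e i|/τ) < #{j : |e j| ≤ |e i|}` (cost `c`
  monotone and non-negative on `[0,∞)`, `τ > 0`): the real quantifier of (bad-3) "local Weyl bound fails"
  ranges over the eigenvalue thresholds only (Borel measurability route).
* `kSeparated_injective` — a `K'`-separated family of open boxes of common side `≥ 2` whose one-sided
  enlargement does not wrap has pairwise distinct corners (no repeated boxes in the Peierls product form);
  `not_siteBox_side_one` — an open box of side `1` is empty.
-/

noncomputable section

namespace Summit.QuantumFields.QCD.Cruxes.SeaFactorisationBridge.ProperTimeQuarantine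

open scoped BigOperators Classical Matrix ComplexConjugate
open Literature.MathematicalPhysics.QuantumFieldTheory Literature.MathematicalPhysics.QuantumLattice
open Literature.Probability.LatticeModels

section Coercive

variable {N : ℕ} [NeZero N]

/-- **Support-form coercivity above the kinetic edge, for EVERY gauge field.**  If `Ω` lies inside an open
box of corner `x` and sides `s ≤ N`, then for every level `0 ≤ κ ≤ μ + Σ_i (1 − cos(π/s_i))` and every `v`
vanishing off the `Ω`-sites, `κ² Σ_p ‖v p‖² ≤ Σ_{p : Ω p.1} ‖(D_W(U, μ, 1) v)_p‖²` (the skeleton's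
`IsCoerciveOn U μ Ω κ`, unfolded).  Proof: `(μ + Σ(1−cos)) ‖v‖² ≤ Re⟨v, D_W v⟩`
(`re_quadForm_wilsonDirac_ge_box`: diamagnetic inequality + Dirichlet path spectrum) and
`Re⟨v, D_W v⟩ ≤ ‖v‖ · ‖P_Ω D_W v‖` (Cauchy–Schwarz; `v` vanishes off `Ω`). -/
theorem isCoerciveOn_of_le_kineticEdge :
    ∀ {N : ℕ} [NeZero N] (U : GaugeConfig 4 N (Matrix.specialUnitaryGroup (Fin 3) ℂ)) (μ : ℝ) (x : TorusSite 4 N)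
      (s : Fin 4 → ℕ), (∀ i, s i ≤ N) → ∀ (Ω : TorusSite 4 N → Prop), (∀ z, Ω z → siteBox x s z) →
      ∀ (κ : ℝ), 0 ≤ κ → κ ≤ μ + ∑ i, (1 - Real.cos (Real.pi / s i)) →
      ∀ (v : TorusSite 4 N × Fin 3 × Fin 4 → ℂ), (∀ p, ¬ Ω p.1 → v p = 0) →
        κ ^ 2 * ∑ p, ‖v p‖ ^ 2 ≤
          ∑ p ∈ Finset.univ.filter (fun p : TorusSite 4 N × Fin 3 × Fin 4 => Ω p.1),
            ‖(wilsonDirac (fundamentalRep (Fin 3)) U μ 1).mulVec v p‖ ^ 2 := by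
  intro N _ U μ x s hs Ω hΩ κ hκ0 hκ v hv
  set D := wilsonDirac (fundamentalRep (Fin 3)) U μ 1 with hD
  have hvbox : ∀ i : TorusSite 4 N × Fin 3 × Fin 4, ¬ siteBox x s i.1 → v i = 0 :=
    fun i hi => hv i fun h => hi (hΩ _ h)
  have key := Summit.QuantumFields.QCD.Theorems.KineticEdge.re_quadForm_wilsonDirac_ge_box
    (fundamentalRep (Fin 3)) fundamentalRep_mem_unitaryGroup U μ x s hs v hvbox
  set Sv := ∑ p, ‖v p‖ ^ 2 with hSv
  set g : TorusSite 4 N × Fin 3 × Fin 4 → ℝ := fun p => if Ω p.1 then ‖(D *ᵥ v) p‖ else 0 with hg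
  have hT : ∑ p ∈ Finset.univ.filter (fun p : TorusSite 4 N × Fin 3 × Fin 4 => Ω p.1), ‖(D *ᵥ v) p‖ ^ 2 =
      ∑ p, g p ^ 2 := by
    rw [Finset.sum_filter]
    refine Finset.sum_congr rfl fun p _ => ?_
    by_cases hp : Ω p.1 <;> simp [hg, hp]
  have hRe : (∑ i, conj (v i) * (D *ᵥ v) i).re ≤ ∑ p, ‖v p‖ * g p := by
    calc (∑ i, conj (v i) * (D *ᵥ v) i).re ≤ ‖∑ i, conj (v i) * (D *ᵥ v) i‖ := Complex.re_le_norm _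
      _ ≤ ∑ i, ‖conj (v i) * (D *ᵥ v) i‖ := norm_sum_le _ _
      _ = ∑ p, ‖v p‖ * g p := by
          refine Finset.sum_congr rfl fun p _ => ?_
          by_cases hp : Ω p.1
          · simp [hg, hp]
          · simp [hg, hp, hv p hp]
  have hCS : (∑ p, ‖v p‖ * g p) ^ 2 ≤ Sv * ∑ p, g p ^ 2 := Finset.sum_mul_sq_le_sq_mul_sq _ _ _
  have hE : μ + ∑ i, (1 - Real.cos (Real.pi / s i)) = μ + 4 - ∑ i, Real.cos (Real.pi / s i) := by
    rw [Summit.QuantumFields.QCD.Theorems.KineticEdge.sum_one_sub_cos]; ring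
  have hSv0 : 0 ≤ Sv := Finset.sum_nonneg fun p _ => by positivity
  have hP0 : 0 ≤ ∑ p, g p ^ 2 := Finset.sum_nonneg fun p _ => by positivity
  have h1 : κ * Sv ≤ ∑ p, ‖v p‖ * g p := by
    have : κ * Sv ≤ (μ + 4 - ∑ i, Real.cos (Real.pi / s i)) * Sv :=
      mul_le_mul_of_nonneg_right (hκ.trans_eq hE) hSv0
    exact this.trans (key.trans hRe)
  rw [hT]
  rcases hSv0.lt_or_eq with hpos | hzero
  · have h2 : (κ * Sv) ^ 2 ≤ Sv * ∑ p, g p ^ 2 :=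
      (pow_le_pow_left₀ (mul_nonneg hκ0 hSv0) h1 2).trans hCS
    have h3 : κ ^ 2 * Sv * Sv ≤ (∑ p, g p ^ 2) * Sv := by nlinarith
    exact le_of_mul_le_mul_right h3 hpos
  · rw [← hzero, mul_zero]
    exact hP0

/-- **Support-form coercivity at every level below the bare mass, for EVERY gauge field** (drop the kinetic
term `Σ(1 − cos) ≥ 0`): for `0 ≤ κ ≤ μ`, every `Ω` inside an open box of sides `≤ N`, and every `v` vanishing
off `Ω`, `κ² ‖v‖² ≤ Σ_{p : Ω p.1} ‖(D_W(U, μ, 1) v)_p‖²`.  In the line's vocabulary: (bad-2) of `BadBox` never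
occurs at a step where the valence bare mass `m_f(k)` is at least the level `c_h a_k m_f/Z_m(k)`. -/
theorem isCoerciveOn_of_le_mass (U : GaugeConfig 4 N (Matrix.specialUnitaryGroup (Fin 3) ℂ)) (μ : ℝ)
    (x : TorusSite 4 N) (s : Fin 4 → ℕ) (hs : ∀ i, s i ≤ N) (Ω : TorusSite 4 N → Prop)
    (hΩ : ∀ z, Ω z → siteBox x s z) (κ : ℝ) (hκ0 : 0 ≤ κ) (hκ : κ ≤ μ)
    (v : TorusSite 4 N × Fin 3 × Fin 4 → ℂ) (hv : ∀ p, ¬ Ω p.1 → v p = 0) :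
    κ ^ 2 * ∑ p, ‖v p‖ ^ 2 ≤
      ∑ p ∈ Finset.univ.filter (fun p : TorusSite 4 N × Fin 3 × Fin 4 => Ω p.1),
        ‖(wilsonDirac (fundamentalRep (Fin 3)) U μ 1).mulVec v p‖ ^ 2 := by
  refine isCoerciveOn_of_le_kineticEdge U μ x s hs Ω hΩ κ hκ0 (hκ.trans ?_) v hv
  have : 0 ≤ ∑ i : Fin 4, (1 - Real.cos (Real.pi / s i)) :=
    Finset.sum_nonneg fun i _ => sub_nonneg.mpr (Real.cos_le_one _)
  linarith

end Coercive

/-- **Finite reduction of a threshold-count event.**  For finitely many reals `e i`, a cost `c` monotone and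
non-negative on `[0, ∞)` and a unit `τ > 0`: some threshold `x ≥ 0` has `c x < #{i : |e i| ≤ x τ}` iff some
INDEX `i` has `c (|e i|/τ) < #{j : |e j| ≤ |e i|}` (take the largest `|e i|` below `x τ`).  Applied to the
sorted eigenvalues of the Dirichlet restriction of `Γ₅ D_W` and `c x = C_W (K + xK)⁴`, this turns the real
quantifier of (bad-3) into a finite disjunction. -/
theorem exists_threshold_iff_exists_index {ι : Type*} [Fintype ι] (e : ι → ℝ) (c : ℝ → ℝ)
    (hc : MonotoneOn c (Set.Ici 0)) (hc0 : ∀ x, 0 ≤ x → 0 ≤ c x) {τ : ℝ} (hτ : 0 < τ) :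
    (∃ x : ℝ, 0 ≤ x ∧ c x < ((Finset.univ.filter fun i => |e i| ≤ x * τ).card : ℝ)) ↔
      ∃ i, c (|e i| / τ) < ((Finset.univ.filter fun j => |e j| ≤ |e i|).card : ℝ) := by
  constructor
  · rintro ⟨x, hx, hlt⟩
    set F := Finset.univ.filter fun i => |e i| ≤ x * τ with hF
    have hne : F.Nonempty := by
      rw [Finset.nonempty_iff_ne_empty]
      intro h
      rw [h, Finset.card_empty, Nat.cast_zero] at hlt
      exact absurd hlt (not_lt.mpr (hc0 x hx))
    obtain ⟨i, hiF, hmax⟩ := F.exists_max_image (fun i => |e i|) hne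
    have hi : |e i| ≤ x * τ := (Finset.mem_filter.mp hiF).2
    refine ⟨i, ?_⟩
    have hset : (Finset.univ.filter fun j => |e j| ≤ |e i|) = F := by
      ext j
      simp only [hF, Finset.mem_filter, Finset.mem_univ, true_and]
      exact ⟨fun h => h.trans hi, fun h => hmax j (Finset.mem_filter.mpr ⟨Finset.mem_univ _, h⟩)⟩
    rw [hset]
    refine lt_of_le_of_lt (hc ?_ hx ((div_le_iff₀ hτ).mpr hi)) hlt
    exact div_nonneg (abs_nonneg _) hτ.le
  · rintro ⟨i, hlt⟩
    refine ⟨|e i| / τ, div_nonneg (abs_nonneg _) hτ.le, ?_⟩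
    rwa [div_mul_cancel₀ _ hτ.ne']

/-- The cost `x ↦ C_W (K + xK)⁴` of (bad-3) is monotone on `[0, ∞)` for `C_W ≥ 0` (hypothesis of
`exists_threshold_iff_exists_index`). -/
theorem monotoneOn_weylCost (CW : ℝ) (hCW : 0 ≤ CW) (K : ℕ) :
    MonotoneOn (fun x : ℝ => CW * ((K : ℝ) + x * K) ^ 4) (Set.Ici 0) := by
  intro a ha b _ hab
  have hK : (0 : ℝ) ≤ K := Nat.cast_nonneg K
  have ha' : 0 ≤ (K : ℝ) + a * K := by have : 0 ≤ a * K := mul_nonneg ha hK; linarith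
  exact mul_le_mul_of_nonneg_left (pow_le_pow_left₀ ha' (by nlinarith) 4) hCW

/-- An open box of side `1` is EMPTY (offsets must lie in `(0, 1)`): at the finitely many steps where the
mesoscopic side `K⌈ℓ/(t a_k)⌉` equals `1`, every box — hence every bad-box indicator — is empty. -/
theorem not_siteBox_side_one {N : ℕ} (y z : TorusSite 4 N) : ¬ siteBox y (fun _ => 1) z := fun h => by
  obtain ⟨h0, h1⟩ := h 0
  dsimp only at h1
  omega

/-- **A `K'`-separated family of non-degenerate boxes has pairwise distinct corners** (the skeleton's
`KSeparated K' side y`, unfolded, as hypothesis): if the common side is `≥ 2` and the one-sided enlargement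
does not wrap (`(K'+1)·side ≤ 2S+1`, implied by the clause's guard `(2K'+1)·side ≤ 2S+1`), then the site
`y_j + (1,1,1,1)` of box `j` lies in the `K'`-fold enlargement of any box with the same corner, so repeated
boxes are excluded from the Peierls product form. -/
theorem kSeparated_injective {S K' side n : ℕ} (y : Fin n → TorusSite 4 (2 * S + 1))
    (hsep : ∀ i j, i ≠ j → ∀ z, siteBox (y j) (fun _ => side) z →
      ¬ siteBox (fun a => y i a - ((K' * side : ℕ) : ZMod (2 * S + 1))) (fun _ => (2 * K' + 1) * side) z)
    (hside : 2 ≤ side) (hwrap : (K' + 1) * side ≤ 2 * S + 1) :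
    Function.Injective y := by
  intro i j hij
  by_contra hne
  have h1lt : 1 + K' * side < 2 * S + 1 := by nlinarith
  have hN : 1 < 2 * S + 1 := by nlinarith
  haveI : Fact (1 < 2 * S + 1) := ⟨hN⟩
  set z : TorusSite 4 (2 * S + 1) := fun a => y j a + 1 with hz
  have hzbox : siteBox (y j) (fun _ => side) z := by
    intro a
    have : z a - y j a = 1 := by rw [hz]; ring
    rw [this, ZMod.val_one]
    exact ⟨Nat.one_pos, hside⟩
  refine hsep i j hne z hzbox fun a => ?_
  have hval : z a - (y i a - ((K' * side : ℕ) : ZMod (2 * S + 1))) =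
      ((1 + K' * side : ℕ) : ZMod (2 * S + 1)) := by
    rw [hz, hij]; push_cast; ring
  rw [hval, ZMod.val_cast_of_lt h1lt]
  refine ⟨by omega, ?_⟩
  nlinarith

end Summit.QuantumFields.QCD.Cruxes.SeaFactorisationBridge.ProperTimeQuarantine
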